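import Summits.Ventures.Crystal3D.Theorems.StickyWulffConstantGenericWallFloorTwistedSquareSeven
import HarnessLib

/-!
# No own-pattern certificate licenses IN-PLANE walkers on h-layers: the in-plane closed star of an hcp ball is a
# sub-pattern of `1743` (crux `GenericWallFloor`, stmt-Ventures-19480, line `WallLedgerG`; lane T's «zigzag deficit»)

HONEST FRAMING. Venture `Summits/Ventures/Crystal3D` (cell `crystal3d-full`), helper `--supports` the crux `GenericWallFloor`
(stmt-Ventures-19480) of `route-Ventures-StickyWulffConstant`, registered line `WallLedgerG`, open stub `stub_twoSlabAdhesion`.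
Rung credit only; F-C1 not moved; NOT the stub.  NEGATIVE bookkeeping for planner cf-p1's ask (b) of 2026-08-28T13:39:45Z
(«what exact-only certificate on h-layer patterns would license in-plane walkers on h-layers»).

A stack walker at `y` is certified by what it OWNS: its predecessor `p = y − u` and the common neighbours of `p` and `y`
in `p`'s (twin) dozen.  For an IN-PLANE step `u` inside an h-layer (anticuboctahedral dozen: hexagon + two eclipsed
polar triples) these are: the hexagon vector `−u`, its two hexagon neighbours, and the ONE eclipsed polar pair adjacent to
`−u` — five vectors, the «in-plane closed star» (stated below as a literal `scaledPattern … 18`, no new defs; integer frame of `hcpInt`: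
`(0,3,−3)` with its hexagon neighbours `(3,0,−3)`, `(−3,3,0)` and the eclipsed pair `(3,3,0)`, `(−1,−1,−4)`;
`hcpInPlaneStarInt_eq_filter`: it IS the set of HCP vectors within distance `1` of `(0,3,−3)`, that vector included).
It is a SUB-PATTERN of the SLOTEX violator `1743` (`hcpInPlaneStarInt_subset_1743`), so the twisted-square dozen of
`…TwistedSquare` is a kissing dozen, not close-packed, containing it: **`not_exactOnly_hcpInPlaneStar`**.  Consequence
(memo WALKER-COVERAGE-g7): on h-layers only the six out-of-plane bonds carry C12-55-type certificates; the «E1-h»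
option is closed — no census can license in-plane h-layer walkers, the zigzag deficit of Barlow|Barlow walls is a limit
of the walker METHOD's own-pattern certification, not of a missing computation.

WHAT THIS IS NOT: not a wall statement; nothing about c-layers (fcc-full balls certify all twelve directions); F-C1 not moved.
-/

noncomputable section

namespace Summit.Ventures.Crystal3D.Theorems

open Finset Literature.Geometry.DiscreteGeometry

/-- **Intrinsic description**: the in-plane closed star `{(3,0,−3), (0,3,−3), (−3,3,0), (3,3,0), (−1,−1,−4)}` (integer
frame of `hcpInt`, norm² `18`: the hexagon vector `(0,3,−3)` = the direction `−u` back to the predecessor, its two hexagon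
neighbours, and the eclipsed polar pair adjacent to it — what an in-plane walker on an h-layer owns) is exactly the set of
HCP vectors within squared distance `18` (distance `1` after scaling) of `(0,3,−3)`, that vector included. -/
theorem hcpInPlaneStarInt_eq_filter :
    ({![3, 0, -3], ![0, 3, -3], ![-3, 3, 0], ![3, 3, 0], ![-1, -1, -4]} : Finset (Fin 3 → ℤ)) =
      hcpInt.filter fun v => sqNormInt (v - ![0, 3, -3]) ≤ 18 := by decide

/-- **The in-plane closed star is a sub-pattern of the violator `1743`.** -/
theorem hcpInPlaneStarInt_subset_1743 :
    ({![3, 0, -3], ![0, 3, -3], ![-3, 3, 0], ![3, 3, 0], ![-1, -1, -4]} : Finset (Fin 3 → ℤ)) ⊆ hcpOwn1743Int := by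
  decide

/-- Five own vectors (as unit vectors). -/
theorem card_hcpInPlaneStar :
    (scaledPattern ({![3, 0, -3], ![0, 3, -3], ![-3, 3, 0], ![3, 3, 0], ![-1, -1, -4]} : Finset (Fin 3 → ℤ)) 18).card = 5 := by
  rw [card_scaledPattern _ (by norm_num)]; decide

/-- The in-plane closed star consists of HCP vectors. -/
theorem hcpInPlaneStar_subset_hcp :
    scaledPattern ({![3, 0, -3], ![0, 3, -3], ![-3, 3, 0], ![3, 3, 0], ![-1, -1, -4]} : Finset (Fin 3 → ℤ)) 18 ⊆
      hcpKissingPattern :=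
  Finset.image_subset_image (by decide : ({![3, 0, -3], ![0, 3, -3], ![-3, 3, 0], ![3, 3, 0], ![-1, -1, -4]} :
    Finset (Fin 3 → ℤ)) ⊆ hcpInt)

/-- The in-plane closed star lies in `O₁₇₄₃`, hence in the twisted-square dozen. -/
theorem hcpInPlaneStar_subset_twistedDozen :
    scaledPattern ({![3, 0, -3], ![0, 3, -3], ![-3, 3, 0], ![3, 3, 0], ![-1, -1, -4]} : Finset (Fin 3 → ℤ)) 18 ⊆
      twistedDozen :=
  (Finset.image_subset_image hcpInPlaneStarInt_subset_1743).trans hcpOwn1743_subset_twistedDozen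

/-- **The in-plane closed star of an hcp ball is NOT exact-only**: the twisted-square dozen (twelve kissing unit vectors,
`13` bonds, not a linear-isometric image of the FCC or HCP pattern) contains it.  So no `ExactOnly`-type certificate
read off an in-plane walker's own pattern exists on h-layers («E1-h» is refuted, not merely uncertified). -/
theorem not_exactOnly_hcpInPlaneStar :
    ¬ ExactOnly 0 (scaledPattern ({![3, 0, -3], ![0, 3, -3], ![-3, 3, 0], ![3, 3, 0], ![-1, -1, -4]} :
      Finset (Fin 3 → ℤ)) 18) :=
  not_exactOnly_zero_of_witness hcpInPlaneStar_subset_twistedDozen card_twistedDozen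
    isKissingArrangement_twistedDozen twistedDozen_not_isometricImage

end Summit.Ventures.Crystal3D.Theorems

end
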